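import Summits.QuantumFields.GaugeBoot.WordSymmetry
import HarnessLib

/-!
# Gauge-boot: canonical loop classes — displacement, free reduction, rotations, hyperoctahedral moves

Cell `pub-gaugeboot` (HOME `run/shared/lean/pub/pub-gaugeboot/`), seat lean1; builds on `WordLoop`,
`WordSymmetry` (this seat) and `LatticeWords` (seat lean2).

HONEST FRAMING (page 1 of every file of this cell): certified bounds on lattice expectations at
STATED coupling, gauge group, dimension and torus size; NOT a mass gap, NOT a continuum limit,
NOT a string tension, NOT large `N`. The venture is explicitly NOT Yang–Mills-summit-bearing
(barriers `FixedCouplingUltralocality`, `PerturbativeInvisibility`).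

## Content

A certificate's variables are CANONICAL loop classes: closed words modulo translations ⋉ `B_d`, cyclic
rotation, reversal and backtracks (KZ2024 §2, GLYZ2025 §2, arXiv:2601.04316 §2). Raw words produced by
Gram blocks and loop-equation rows must be identified with class representatives IN EXPECTATION. This
file makes that identification a COMPUTATION checked by `decide`:

* `Word.disp w : Fin d → ℤ`, the net displacement; `Word.endpoint x w = x + disp w (mod L)`, so
  `disp w = 0` certifies closedness on EVERY torus (`Word.endpoint_eq_self_of_disp`);
* `Word.freeReduce` (backtrack cancellation, holonomy-preserving: `wordHolonomy_freeReduce`);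
* `k`-fold cyclic rotation `List.rotate` of a closed word preserves `⟨W⟩` (`wilsonExpectation_wordLoop_rotateN`);
* hyperoctahedral MOVES at the origin (`Move.perm π`, `Move.refl0`, `Move.refl k`; `Word.acts`), preserving `⟨W_0⟩`
  (`wilsonExpectation_wordLoop_acts`);
* the pipeline `Word.canon ms rev k₁ k₂ w := rotate k₂ (freeReduce (rotate k₁ (reverse? (acts ms w))))` and
  the master lemma `wilsonExpectation_wordLoop_canon`: `⟨W_0(w)⟩_β = ⟨W_0(canon ms rev k₁ k₂ w)⟩_β` whenever
  `disp (acts ms w) = 0` — so an identification `⟨W_0(w)⟩ = ⟨W_0(w')⟩` is proved by exhibiting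
  `(ms, rev, k₁, k₂)` with `canon ms rev k₁ k₂ w = w'`, a closed computation (`decide`).

Pure combinatorics plus the invariances of `WordLoop` / `WordSymmetry`; nothing here depends on `β`, `N`
or the group beyond continuity of `ρ`.
-/

noncomputable section

open MeasureTheory
open Literature.MathematicalPhysics.QuantumFieldTheory

namespace Summit.QuantumFields.GaugeBoot

/-! ## Net displacement and closedness on every torus -/

namespace Step

variable {d : ℕ}

/-- Net displacement of a step: `+e_μ ↦ e_μ`, `-e_μ ↦ -e_μ` (as an integer vector). [folklore] -/
def disp : Step d → Fin d → ℤ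
  | fwd μ => Pi.single μ 1
  | bwd μ => -Pi.single μ 1

/-- A step moves its base point by its displacement (mod `L`). [folklore] -/
theorem apply_eq_add_disp {L : ℕ} (x : Site d L) (s : Step d) :
    s.apply x = x + fun k => ((s.disp k : ℤ) : ZMod L) := by
  cases s with
  | fwd μ =>
    simp only [apply_fwd, Site.shift, disp]
    congr 1
    funext k
    by_cases hk : k = μ
    · subst hk; simp
    · simp [Pi.single_eq_of_ne hk]
  | bwd μ =>
    simp only [apply_bwd, disp, sub_eq_add_neg]
    congr 1
    funext k
    by_cases hk : k = μ
    · subst hk; simp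
    · simp [Pi.single_eq_of_ne hk]

/-- `disp (s⁻¹) = -disp s`. [folklore] -/
@[simp] theorem disp_inv (s : Step d) : s.inv.disp = -s.disp := by
  cases s <;> simp [disp, inv]

end Step

namespace Word

variable {d L : ℕ}

/-- Net displacement of a word: the sum of the displacements of its steps. [folklore] -/
def disp (w : Word d) : Fin d → ℤ := (w.map Step.disp).sum

/-- `disp [] = 0`. [folklore] -/
@[simp] theorem disp_nil : disp ([] : Word d) = 0 := rfl

/-- `disp (s :: w) = disp s + disp w`. [folklore] -/
@[simp] theorem disp_cons (s : Step d) (w : Word d) : disp (s :: w) = s.disp + disp w := by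
  simp [disp]

/-- `disp (v ++ w) = disp v + disp w`. [folklore] -/
@[simp] theorem disp_append (v w : Word d) : disp (v ++ w) = disp v + disp w := by
  simp [disp, List.sum_append]

/-- **Endpoint = base point + net displacement (mod `L`).** [folklore] -/
theorem endpoint_eq_add_disp (x : Site d L) (w : Word d) :
    endpoint x w = x + fun k => ((disp w k : ℤ) : ZMod L) := by
  induction w generalizing x with
  | nil => funext k; simp
  | cons s w ih =>
    rw [endpoint_cons, ih, Step.apply_eq_add_disp, disp_cons, add_assoc]
    congr 1
    funext k
    simp [Int.cast_add]

/-- A word with zero net displacement is closed at every base point of every torus. [folklore] -/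
theorem endpoint_eq_self_of_disp (x : Site d L) {w : Word d} (hw : disp w = 0) : endpoint x w = x := by
  rw [endpoint_eq_add_disp, hw]
  ext k
  simp

/-- Displacement is invariant under permutations of the list of steps (e.g. rotations). [folklore] -/
theorem disp_eq_of_perm {v w : Word d} (h : v.Perm w) : disp v = disp w :=
  (h.map Step.disp).sum_eq

/-- `disp (w.rotate k) = disp w`. [folklore] -/
@[simp] theorem disp_rotate (w : Word d) (k : ℕ) : disp (w.rotate k) = disp w :=
  disp_eq_of_perm (List.rotate_perm w k)

/-- `disp (reverse w) = -disp w`. [folklore] -/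
@[simp] theorem disp_reverse (w : Word d) : disp (reverse w) = -disp w := by
  induction w with
  | nil => simp [reverse]
  | cons s w ih =>
    rw [reverse_cons, disp_append, ih, disp_cons, disp_cons, disp_nil, Step.disp_inv]
    abel

/-! ## Free reduction (cancellation of backtracks `s s⁻¹`) -/

/-- Free reduction of a word: cancel adjacent backtracks `s s⁻¹`, innermost first (the usual stack
algorithm, recursing on the tail). [folklore] -/
def freeReduce : Word d → Word d
  | [] => []
  | s :: w =>
    match freeReduce w with
    | [] => [s]
    | t :: v => if t = s.inv then v else s :: t :: v

/-- `freeReduce` preserves the net displacement. [folklore] -/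
@[simp] theorem disp_freeReduce (w : Word d) : disp (freeReduce w) = disp w := by
  induction w with
  | nil => rfl
  | cons s w ih =>
    simp only [freeReduce, disp_cons]
    rcases hred : freeReduce w with _ | ⟨t, v⟩
    · rw [hred] at ih; simp [← ih]
    · rw [hred] at ih
      by_cases ht : t = s.inv
      · subst ht
        simp only [↓reduceIte]
        rw [← ih, disp_cons, Step.disp_inv]
        abel
      · simp only [ht, ↓reduceIte, disp_cons]
        rw [← ih, disp_cons]

end Word

/-! ## Holonomy and loop variable under free reduction -/

section Reduce

variable {d L N : ℕ} {G : Type*} [Group G]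

/-- One step of free reduction, seen through the holonomy: `hol_x(red(s·w)) = U_s · hol_{x+s}(red(w))`
(the cancelled backtrack contributes `U_s U_s⁻¹ = 1`). [folklore] -/
theorem wordHolonomy_freeReduce_cons (U : GaugeConfig d L G) (x : Site d L) (s : Step d) (w : Word d) :
    wordHolonomy U x (Word.freeReduce (s :: w)) =
      stepHolonomy U x s * wordHolonomy U (s.apply x) (Word.freeReduce w) := by
  cases hfw : Word.freeReduce w with
  | nil => simp [Word.freeReduce, hfw]
  | cons t v =>
    by_cases ht : t = s.inv
    · subst ht
      simp only [Word.freeReduce, hfw, ↓reduceIte, wordHolonomy_cons, stepHolonomy_apply_inv,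
        Step.apply_inv_apply, ← mul_assoc, mul_inv_cancel, one_mul]
    · simp only [Word.freeReduce, hfw, ht, ↓reduceIte, wordHolonomy_cons]

/-- **Free reduction preserves the holonomy** (backtracks contribute `U_e U_e⁻¹ = 1`). [folklore] -/
theorem wordHolonomy_freeReduce (U : GaugeConfig d L G) :
    ∀ (w : Word d) (x : Site d L), wordHolonomy U x (Word.freeReduce w) = wordHolonomy U x w
  | [], _ => rfl
  | s :: w, x => by
    rw [wordHolonomy_freeReduce_cons, wordHolonomy_freeReduce U w (s.apply x), wordHolonomy_cons]

variable [TopologicalSpace G] [IsTopologicalGroup G] [CompactSpace G] [MeasurableSpace G] [BorelSpace G]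
  (ρ : G →* Matrix (Fin N) (Fin N) ℂ)

omit [TopologicalSpace G] [IsTopologicalGroup G] [CompactSpace G] [MeasurableSpace G] [BorelSpace G] in
/-- Free reduction does not change the loop variable (pointwise). [folklore] -/
theorem wordLoop_freeReduce (x : Site d L) (w : Word d) :
    wordLoop ρ x (Word.freeReduce w) = wordLoop (G := G) ρ x w := by
  funext U
  simp only [wordLoop_apply, wordHolonomy_freeReduce]

end Reduce

/-! ## Rotations of closed words -/

section Rotate

variable {d L N : ℕ} {G : Type*} [Group G] [TopologicalSpace G] [IsTopologicalGroup G]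
  [CompactSpace G] [MeasurableSpace G] [BorelSpace G] (ρ : G →* Matrix (Fin N) (Fin N) ℂ) [NeZero L]

/-- **`k`-fold cyclic rotation of a closed word preserves `⟨W⟩`** (closedness certified by
`disp w = 0`, valid on every torus). [folklore] -/
theorem wilsonExpectation_wordLoop_rotateN (β : ℝ) (x : Site d L) :
    ∀ (k : ℕ) (w : Word d), Word.disp w = 0 →
      wilsonExpectation ρ β (wordLoop (G := G) ρ x (w.rotate k)) = wilsonExpectation ρ β (wordLoop ρ x w)
  | 0, w, _ => by rw [List.rotate_zero]
  | k + 1, [], _ => by rw [List.rotate_nil]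
  | k + 1, s :: w, hw => by
    rw [List.rotate_cons_succ]
    have hw' : Word.disp (w ++ [s]) = 0 := by
      rw [← hw, Word.disp_append, Word.disp_cons, Word.disp_cons, Word.disp_nil]; abel
    rw [wilsonExpectation_wordLoop_rotateN β x k (w ++ [s]) hw',
      wilsonExpectation_wordLoop_rotate ρ β x s w (Word.endpoint_eq_self_of_disp x hw)]

end Rotate

/-! ## Hyperoctahedral moves at the origin -/

namespace Step

variable {d : ℕ}

/-- The reflection of axis `k`: `±e_k ↦ ∓e_k`, other steps unchanged. [folklore] -/
def reflectAxis (k : Fin d) : Step d → Step d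
  | fwd μ => if μ = k then bwd μ else fwd μ
  | bwd μ => if μ = k then fwd μ else bwd μ

/-- `reflectAxis 0` is `reflect0`. [folklore] -/
theorem reflectAxis_zero [NeZero d] (s : Step d) : s.reflectAxis 0 = s.reflect0 := by
  cases s <;> rfl

/-- The reflection of axis `k` is the reflection of axis `0` conjugated by the transposition `(0 k)`. [folklore] -/
theorem reflectAxis_eq_conj [NeZero d] (k : Fin d) (s : Step d) :
    s.reflectAxis k = ((s.permute (Equiv.swap 0 k)).reflect0).permute (Equiv.swap 0 k) := by
  have hiff : ∀ μ : Fin d, Equiv.swap (0 : Fin d) k μ = 0 ↔ μ = k := fun μ => by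
    rw [Equiv.apply_eq_iff_eq_symm_apply, Equiv.symm_swap, Equiv.swap_apply_left]
  cases s with
  | fwd μ =>
    by_cases h : μ = k
    · subst h; simp [reflectAxis, reflect0, permute]
    · have h' : ¬ Equiv.swap (0 : Fin d) k μ = 0 := fun h0 => h ((hiff μ).1 h0)
      simp [reflectAxis, reflect0, permute, h, h']
  | bwd μ =>
    by_cases h : μ = k
    · subst h; simp [reflectAxis, reflect0, permute]
    · have h' : ¬ Equiv.swap (0 : Fin d) k μ = 0 := fun h0 => h ((hiff μ).1 h0)
      simp [reflectAxis, reflect0, permute, h, h']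

end Step

/-- A generator of the hyperoctahedral group acting on steps: a permutation of the axes, the
reflection of axis `0`, or the reflection of axis `k`. [folklore] -/
inductive Move (d : ℕ) : Type
  | perm (π : Equiv.Perm (Fin d))
  | refl0
  | refl (k : Fin d)

namespace Move

variable {d : ℕ} [NeZero d]

/-- The action of a move on steps. [folklore] -/
def act : Move d → Step d → Step d
  | perm π => Step.permute π
  | refl0 => Step.reflect0
  | refl k => Step.reflectAxis k

end Move

namespace Word

variable {d : ℕ} [NeZero d]

/-- Apply a list of moves to a word (the LAST move of the list acts first). [folklore] -/
def acts (ms : List (Move d)) (w : Word d) : Word d :=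
  ms.foldr (fun m v => v.map m.act) w

/-- `acts [] w = w`. [folklore] -/
@[simp] theorem acts_nil (w : Word d) : acts [] w = w := rfl

/-- `acts (m :: ms) w = (acts ms w).map m.act`. [folklore] -/
@[simp] theorem acts_cons (m : Move d) (ms : List (Move d)) (w : Word d) :
    acts (m :: ms) w = (acts ms w).map m.act := rfl

/-- The canonicalisation pipeline: hyperoctahedral moves, optional reversal, rotation, free reduction,
rotation. [folklore] -/
def canon (ms : List (Move d)) (rev : Bool) (k₁ k₂ : ℕ) (w : Word d) : Word d :=
  (freeReduce ((if rev then reverse (acts ms w) else acts ms w).rotate k₁)).rotate k₂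

end Word

section Moves

variable {d L N : ℕ} [NeZero d] {G : Type*} [Group G] [TopologicalSpace G] [IsTopologicalGroup G]
  [CompactSpace G] [MeasurableSpace G] [BorelSpace G] (ρ : G →* Matrix (Fin N) (Fin N) ℂ) [NeZero L]

omit [NeZero d] [NeZero L] in
/-- The origin is fixed by axis permutations. [folklore] -/
theorem sitePerm_zero (π : Equiv.Perm (Fin d)) : sitePerm π (0 : Site d L) = 0 := rfl

omit [NeZero L] in
/-- The origin is fixed by the reflection of axis `0`. [folklore] -/
theorem negReflect_zero : (0 : Site d L).negReflect = 0 := by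
  funext k
  by_cases hk : k = 0
  · subst hk; simp
  · exact WilsonSiteRP.negReflect_apply_of_ne _ hk

/-- **A move at the origin preserves `⟨W_0⟩`.** [folklore] -/
theorem wilsonExpectation_wordLoop_act (hρ : Continuous ρ) (β : ℝ) (m : Move d) (w : Word d) :
    wilsonExpectation ρ β (wordLoop (G := G) ρ (0 : Site d L) (w.map m.act)) =
      wilsonExpectation ρ β (wordLoop ρ (0 : Site d L) w) := by
  cases m with
  | perm π =>
    have h := wilsonExpectation_wordLoop_permute (d := d) (L := L) (G := G) ρ hρ β π 0 w
    rw [sitePerm_zero] at h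
    exact h.symm
  | refl0 =>
    have h := wilsonExpectation_wordLoop_reflect0 (d := d) (L := L) (G := G) ρ hρ β 0 w
    rw [negReflect_zero] at h
    exact h.symm
  | refl k =>
    -- conjugate the axis-`0` reflection by the transposition `(0 k)`
    set σ : Equiv.Perm (Fin d) := Equiv.swap 0 k with hσ
    have hw : w.map (Move.refl k).act = ((w.map (Step.permute σ)).map Step.reflect0).map (Step.permute σ) := by
      simp only [List.map_map]
      exact List.map_congr_left fun s _ => Step.reflectAxis_eq_conj k s
    have h1 := wilsonExpectation_wordLoop_permute (d := d) (L := L) (G := G) ρ hρ β σ 0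
      ((w.map (Step.permute σ)).map Step.reflect0)
    have h2 := wilsonExpectation_wordLoop_reflect0 (d := d) (L := L) (G := G) ρ hρ β 0 (w.map (Step.permute σ))
    have h3 := wilsonExpectation_wordLoop_permute (d := d) (L := L) (G := G) ρ hρ β σ 0 w
    rw [sitePerm_zero] at h1 h3
    rw [negReflect_zero] at h2
    rw [hw, ← h1, ← h2, ← h3]

/-- **A list of moves at the origin preserves `⟨W_0⟩`.** [folklore] -/
theorem wilsonExpectation_wordLoop_acts (hρ : Continuous ρ) (β : ℝ) (ms : List (Move d)) (w : Word d) :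
    wilsonExpectation ρ β (wordLoop (G := G) ρ (0 : Site d L) (Word.acts ms w)) =
      wilsonExpectation ρ β (wordLoop ρ (0 : Site d L) w) := by
  induction ms with
  | nil => rfl
  | cons m ms ih => rw [Word.acts_cons, wilsonExpectation_wordLoop_act ρ hρ β m, ih]

/-- **Master identification lemma.** For a word `w` whose image under the moves `ms` has zero net
displacement (a decidable condition), `⟨W_0(w)⟩_β = ⟨W_0(canon ms rev k₁ k₂ w)⟩_β` on every torus: two raw
words with the same canonical form have the same torus expectation. [folklore] -/
theorem wilsonExpectation_wordLoop_canon (hρ : Continuous ρ) (β : ℝ) (ms : List (Move d)) (rev : Bool)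
    (k₁ k₂ : ℕ) (w : Word d) (hw : Word.disp (Word.acts ms w) = 0) :
    wilsonExpectation ρ β (wordLoop (G := G) ρ (0 : Site d L) w) =
      wilsonExpectation ρ β (wordLoop ρ (0 : Site d L) (Word.canon ms rev k₁ k₂ w)) := by
  rw [← wilsonExpectation_wordLoop_acts ρ hρ β ms w]
  set v := Word.acts ms w with hv
  -- optional reversal
  set v₁ := (if rev then Word.reverse v else v) with hv₁
  have hv₁d : Word.disp v₁ = 0 := by
    rw [hv₁]; split_ifs <;> simp [hw]
  have h1 : wilsonExpectation ρ β (wordLoop (G := G) ρ (0 : Site d L) v) =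
      wilsonExpectation ρ β (wordLoop ρ (0 : Site d L) v₁) := by
    rw [hv₁]
    by_cases hrev : rev
    · simp only [hrev, ↓reduceIte, wordLoop_reverse ρ hρ 0 v (Word.endpoint_eq_self_of_disp 0 hw)]
    · simp only [hrev]
      rfl
  -- first rotation, free reduction, second rotation
  have h2 := wilsonExpectation_wordLoop_rotateN (G := G) ρ β (0 : Site d L) k₁ v₁ hv₁d
  have h3 : wordLoop ρ (0 : Site d L) (Word.freeReduce (v₁.rotate k₁)) =
      wordLoop (G := G) ρ 0 (v₁.rotate k₁) := wordLoop_freeReduce ρ 0 _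
  have h4 := wilsonExpectation_wordLoop_rotateN (G := G) ρ β (0 : Site d L) k₂
    (Word.freeReduce (v₁.rotate k₁)) (by simp [hv₁d])
  unfold Word.canon
  rw [← hv, ← hv₁, h4, h3, h2, h1]

end Moves

end Summit.QuantumFields.GaugeBoot

end
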